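import Summits.QuantumFields.YangMills.Theorems.BalabanUVNodesN05SubBP2DSlotExistsOfThm33JunctionHWithQQPP6
import Literature.MathematicalPhysics.QuantumFieldTheory.Balaban1983to89.B9SupplySockB9P3ZdInstance
import Literature.MathematicalPhysics.QuantumFieldTheory.Balaban1983to89.B9SupplySockB9P3ZdLocalLettersOfOps
import Literature.MathematicalPhysics.QuantumFieldTheory.Balaban1983to89.B9SupplySockB9P3ZdGammaInAkDpZd

/-!
# BalabanUVNodes ∕ N05 ([Balaban1985RegularSpaces] Lemma 1 p. 79 – Thm 8 p. 101): THE J-N06→N05 JUNCTION APPLIED ON THE «P₂D» ROAD AT N06's FULL `ℤᵈ` FRAME OF RECORD —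
# `BalabanUVNodesN05SubBP2DSlotExistsOfThm33JunctionHWithQQPP6` with the REST of dag-n06-e's frame pinned, `(geo, GA, ιLoc) := (geoZd, GAZdFamOfOps … ops, ιLocZd)`,
# and the curvature letter `Δ′(U₀)` genuine (dag-n06-w2's `withDpZd`): the dictionary binder `hdict` and the (3.69) binder `hcurv` are THEOREMS of N06's lane
# (dag-n06-e's `dictGlob_zd`, dag-n06-w2's `curvAtInAk_of_Dp_eq` ∘ `B9Eq369CurvSmallZd`), so SIX junction binders remain displayed instead of eight, and N06's
# Theorem 3.3 is read as ITS NODE SENTENCE (γ) VERBATIM: `B9.Thm33Printed c35 (geoZd θ.𝔸 θ.L len) (bgZd θ.𝔸 θ.L) Gp (GAZdFamOfOps θ.𝔸 θ.L len ops)`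

Track A of `YM-PLAN.md` (cell `pub-ymgap`, HUMAN RULING D-0062), node **N05** = [Balaban1985RegularSpaces] («B8»), in-edge **N06** = [Balaban1985BackgroundPropagators]
(«B9», print's ref. [4]); seat `pub-ymgap-dag-n05-d` (g14), 2026-08-28; bears on K1⁹ `stmt-QuantumFields-27364` (`--supports … --as helper`, count-neutral).

WHY.  The N05 row of record on the «P₂D» road (dag-n05-d g13 `…OfThm33JunctionHWithQQP`, dag-n05-e g17 `…WithQQPP6`) reads N06 through an ABSTRACT half-frame
`(geo, Gp, GA, ιLoc, ops)` over `MemberZd θ.D θ.L`: the junction binder `DictAt geo bg GA L mem ιCfg ιLoc ops M i m` ([4] (3.41) ∕ (3.47): «the member's block parameter is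
`M`; its `γ = −3` weighted norm of a bond field is `|J|₍₋₃₎`; the `γ = −3` global entries n = 0, 1, 3 of (3.47) for `G(U₀)` ARE `|G(U₀)J|₍₋₁₎`, `|∇G(U₀)J|₍₋₂₎`,
`|ΔG(U₀)J|₍₋₃₎`») only RELATES the abstract kernel family `GA` to the letters `ops`, and the binder `CurvAtInAk L ops c69 M i m` ([4] (3.69): «`(Lʲη)³|Δ′(U₀)A| ≤
c69·M·α₀·|A|₍₋₁₎` for `U₀ ∈ 𝔄_m({Ω_j}, α₀)`») reads the `Dp` letter of `ops` only.  Both are THEOREMS of N06's lane once the frame is N06's own: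
* dag-n06-e's `ℤᵈ` FRAME OF RECORD `B9SupplySockB9P3ZdFrame` ∕ `…Instance` ∕ `…LocalLettersOfOps`: `geoZd 𝔸 L len` (geometries: blocks, lengths `Lʲη`, the norms
  (3.39)–(3.41), cut-offs), `bgZd 𝔸 L` (the genuine class (3.35)), `ιCfgZd ∕ ιLocZd` (configurations ∕ bond fields read as themselves), and the kernel family
  `GAZdFamOfOps 𝔸 L len ops x := GAZd … (ops x.M x.i x.m) (locOfOpsZd …)` whose EVERY entry (3.42)–(3.47) is READ OFF the operator letters — «N06's node sentence at
  the `ℤᵈ` instance ABOUT THE OPERATOR `G(U₀)`» (dag-n06-e, `…LocalLettersOfOps` §2); there `DictGlob … ops` holds for every `ops` (`dictGlob_zd`, by `rfl` and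
  `2 + (−3) = −1`, `1 + (−3) = −2`), hence `DictAt` at every member (`dictAt_of_global`, dag-n06-b).
* dag-n06-w2's GENUINE CURVATURE LETTER `withDpZd` (`Dp := DpZd i.η`, [4] (3.10) «Δ = D*D + Δ′») with (3.69) PROVED on `ℤᵈ` for every member, `1 ≤ L`, `1 ≤ M`
  (`B9Eq369CurvSmallZd.curvSmall_inAk_of_Dp_eq_M` → `curvAtInAk_of_Dp_eq`, constant `c69 = 14(d−1)`).
So the N05 row needs SIX junction binders (`InvAtH ∕ LandauAt ∕ HolderAtδ2 ∕ LinBddAt ∕ SrcAt ∕ SrcHolderAtδ2`) + [4]'s letters + N06's Theorem 3.3 in its own sentence.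

WHAT IS PINNED, EXHAUSTIVELY (vs dag-n05-e's `…_P6`): (i) `geo := geoZd θ.𝔸 θ.L len`, `GA := GAZdFamOfOps θ.𝔸 θ.L len ops`, `ιLoc := ιLocZd θ.𝔸 θ.L len` — so the
length function `len` (already read by `HolderAtδ2 ∕ SrcHolderAtδ2` and by the leaf's `lam.len`) is bound BEFORE `Gp`, explicitly; `Gp` (Theorems 3.1–3.2's family, read
by `Thm33Printed` only) stays free; (ii) the letter pin `hops` now reads `ops M i m = withQQP τ θ.L (towerBondsP-class of i) (withDpZd ops₀) M i m` — `Q*aQ` genuine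
(EDITION P, as before) AND `Δ′` genuine; `Gop` and `D R(U₀) D*` stay `ops₀`'s FREE letters; (iii) `hdict`, `hcurv`, `c69`, `hc69` gone; every other hypothesis VERBATIM
(same texts, same guards `1 ≤ M → M₃ ≤ M → m ≤ j.k →`, same order).

WHY `Gop` ∕ `DRDs` ARE NOT PINNED HERE (LOCATED, dag-n05-d g13 JUNCTION ROAD NOTE, cell bus 2026-08-28): the members of the «P₂D» index have `Ω₀ = ℤᵈ`
(`IdxB8SubD.Ω_zero`); N06's object `G(U₀) = (Ω₀Δ_aΩ₀)⁻¹` (`B9Eq327GreenZd.gopZd`, dag-n06-w4) is the inverse of an algebraic bijection of `E(Ω₀)` when `RegularAt`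
holds and `0` otherwise, and its `InvAt` supplier `invAt_opsAllZd_of_posDef` asks `(i.Ω 0).Finite`; at `Ω₀ = ℤᵈ` the pin would make `InvAtH` UNSATISFIABLE (vacuous
row).  The infinite-volume letters are [4] Theorem 3.1's content (dag-n05-c g16's pricing; dag-n05-w1's `B9Thm31MassiveSiteResolventLinftyZd` is the massive case).

INDEX NOTE (dag-n06-b g20 LOCATED-SELF-7 COROLLARY, cell bus 2026-08-28: N06's frame-keyed sentence for the GENUINE `G_𝔤` is FALSE over any index containing a
`cubeFam false` member, SOUND over indices of `Ω₀ = ℤᵈ` members).  Here the index is the FULL `MemberZd θ.D θ.L` (dag-n05-e's `…_P6` pins it) but `ops` is a FREE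
member-indexed letter family pinned only in its `Q*aQ` ∕ `Δ′` letters: the hypothesis set never forces the genuine `G(U₀)` at an inadmissible member (the binders read
the (1.3)–(1.5)-admissible `Ω₀ = ℤᵈ` members `memZd M j m`, `j : IdxB8SubD θ`, only), so it is NOT made vacuous by that corollary; the SOUND-SUB-INDEX reading
(index `I`, re-indexing map `π : I → MemberZd`, N06's sentence over `I` only) is the §2 edition owed on dag-n05-e's `…_P6I` (v1.1 of p629759), same pins.

WHAT IS PROVED (one theorem; no estimate by this seat; no new definition):
* ★★★ **`exists_residB8_b8LeafOfRecordSubBP₂D_cutSubBP₅_of_letters_thm33_junctionH_zdFrame`** — for `θ : Node00.Stage3Params` with `2 ≤ θ.D`, `5 ≤ θ.L`: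
  `∃ c35₀ M₆ > 0, ∀ c35 ≥ c35₀, ∀ M₃ ≥ M₆,` [4]'s letters `SLet ∕ SLetUB` (dag-n05-d p619291's texts verbatim), ANY `len`, ANY (3.8)-family `Gp`, ANY letter family `ops`
  pinned by `hops` to the genuine `Q*aQ` and `Δ′`, N06's **`B9.Thm33Printed c35 (geoZd θ.𝔸 θ.L len) (bgZd θ.𝔸 θ.L) Gp (GAZdFamOfOps θ.𝔸 θ.L len ops)` BY NAME**, and
  the SIX junction binders at every `j : IdxB8SubD θ`, guarded `1 ≤ M → M₃ ≤ M → m ≤ j.k →` ⊢ `∃ lam c₁ ρ₀, B8LeafOfRecordSubBP₂D θ (lam.cutSubBP₅ c₁ ρ₀)`.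
  Proof: ONE application of dag-n05-e's `…_P6` at `(geoZd, Gp, GAZdFamOfOps ops, ιLocZd, ops)` with `ops₀ := withDpZd ops₀`, `hdict := dictAt_of_global (dictGlob_zd …)`
  (through `GAZdFamOfOps_eq`), `hcurv := curvAtInAk_of_Dp_eq` (the pin gives `(ops M i m).Dp = DpZd i.η` by `withQQP_Dp`, `withDpZd_Dp`), `hc69 := 0 ≤ 14(D−1)`.
HONEST FRAMING: by-name composition (dag-n05-e's p629759 ∘ dag-n06-e's dictionary ∘ dag-n06-w2's (3.69)); 0 estimates by this seat; [4] (3.69) on `ℤᵈ` and the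
dictionary are CONSUMED (tree theorems), nothing else of [4] is proved; the displayed [4] letters, `Thm33Printed` (now at N06's own frame, about the operator `ops`
carries) and the six junction binders are HYPOTHESES (N06's object layer `G(U₀) ∕ R(U₀)` on `Ω₀ = ℤᵈ`, `m ≥ 1` OPEN; class-wide satisfiability NOT claimed; no
positive A6 witness claimed); CLASS NOTE (dag-n05-w2 `B8IdxB8SubDPrintClassGap`: binders over ALL `IdxB8SubD` members ⊋ print's (1.3)–(1.4) class; exit = one
`Subtype` cut) applies verbatim; Proposition 7 in the repaired currency (WATCH-P7-CURRENCY-RECORD); count-neutral; **N05 NOT discharged**; K1⁹ NOT claimed;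
Bałaban AS PRINTED; one finite 𝕋⁴ programme at fixed ε; nothing continuum ∕ ℝ⁴ ∕ OS ∕ mass-gap ∕ Clay.  No `sorry`, no new definition.  Unit `pub-ymgap-dag-n05-d` (g14).
[cite: Balaban1985RegularSpaces, Lemma 1 – Thm 8 pp.79–101, (1.3)–(1.5) p.77, (1.59) p.86; Balaban1985BackgroundPropagators, (3.10) p.392, (3.35) p.396, (3.39)–(3.41) p.397, (3.42)–(3.47) pp.397–398, Thm 3.3 p.399, (3.69) p.404]
v1.1 (APPEND-ONLY, same seat, 2026-08-28): §2 `…_zdFrameI` — THE INDEX-GENERIC EDITION on dag-n05-e's `…_P6I` (v1.1 of p629759): any index `I` with a re-indexing map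
`π : I → MemberZd θ.D θ.L` and `hmem : π (mem M j m) = memZd M j m` at the admissible members; the frame of record READ THROUGH `π` (`geoZd ∘ π`, `bgZd ∘ π`,
`GAZdFamOfOps … ops ∘ π`, locality map the identity), N06's sentence over `I` only (sound sub-indices are the consumer's choice — the INDEX NOTE's reading); same pins,
same two discharges (`hdict` transported along `hmem`, `hcurv`); §1 byte-identical.
-/

noncomputable section

namespace Summit.QuantumFields.YangMills.BalabanUVNodes.N05SubBP2DSlotExistsOfThm33JunctionHAtZdFrame

open Literature.MathematicalPhysics.QuantumFieldTheory.Balaban1983to89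
open Literature.MathematicalPhysics.QuantumFieldTheory.Balaban1983to89.Node00
open Literature.MathematicalPhysics.QuantumFieldTheory.Balaban1983to89.B8IdxB8LawsB (IdxB8LawsB)
open Literature.MathematicalPhysics.QuantumFieldTheory.Balaban1983to89.B8LeafModelZd (ZdIdx)
open Literature.MathematicalPhysics.QuantumFieldTheory.Balaban1983to89.B8TowerBondsPrinted (towerBondsP)
open Literature.MathematicalPhysics.QuantumFieldTheory.Balaban1983to89.B8SockLettersRD (SockLettersRD)
open Literature.MathematicalPhysics.QuantumFieldTheory.Balaban1983to89.B8Eq138LandauZd (covLap QT)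
open B7Prop1Explicit B7Prop2Explicit B7Prop1Local
open B8Ineq132 (InAk covDerivFwd)
open B7Eq78Linearization (zdBlocking QprimeIter)
open B8Eq119TwistedAxial (bgT)
open B8Eq140Level (SideTouches)
open B8Eq1117Concrete (XSpace)
open B8Prop5ContractionKLevel (Bd2)
open B8LambdaSpaceKLevel (wt)

open B9SupplySockB9P3ZdLetters (OpsZd DictGlob)
open B9SupplySockB9P3ZdAt (DictAt LandauAt SrcAt dictAt_of_global)
open B9SupplySockB9P3ZdAtLin (LinBddAt)
open B9SupplySockB9P3ZdGammaUnivDelta2 (HolderAtδ2)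
open B9SupplySockB9P3ZdAtHerm (InvAtH)
open B9SupplySockB9P3ZdGammaUnivDelta2Src (SrcHolderAtδ2)
open B9SupplySockB9P3ZdFrame (MemberZd memZd bgZd ιCfgZd geoZd ιLocZd)
open B9SupplySockB9P3ZdLocalLettersOfOps (GAZdFamOfOps GAZdFamOfOps_eq)
open B9SupplySockB9P3ZdInstance (dictGlob_zd)
open B9SupplySockB9P3ZdGammaInAkDpZd (withDpZd withDpZd_Dp curvAtInAk_of_Dp_eq)
open B9Eq369CurvSmallZd (DpZd)
open B9Eq316AveragingTransposeZdPrinted (withQQP withQQP_Dp)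
open Summit.QuantumFields.YangMills.BalabanUVNodes.N05SubBP2DSlotExistsOfThm33JunctionHWithQQPP6
  (exists_residB8_b8LeafOfRecordSubBP₂D_cutSubBP₅_of_letters_thm33_junctionH_withQQP_P6)

-- `Site` alone could resolve to the torus sites of `Setup.lean`; re-export the `ℤ^d` sites of `B7Prop1Explicit`.
export B7Prop1Explicit (Site)

section AtZdFrame

/-- ★★★ **THE J-N06→N05 JUNCTION APPLIED ON THE «P₂D» ROAD AT N06's FULL `ℤᵈ` FRAME OF RECORD, THE DICTIONARY AND THE (3.69) BINDERS DISCHARGED** — for `θ` with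
`2 ≤ θ.D`, `5 ≤ θ.L`: Proposition 6 produces `c35₀, M₆ > 0` such that for every leaf constant `c35 ≥ c35₀` and every junction floor `M₃ ≥ M₆`, [4]'s letters `SLet ∕ SLetUB`,
any length function `len`, any (3.8)-family `Gp`, any letter family `ops` whose `Q*aQ` and `Δ′(U₀)` letters are the genuine ones (`hops`), N06's node sentence
`B9.Thm33Printed c35 (geoZd θ.𝔸 θ.L len) (bgZd θ.𝔸 θ.L) Gp (GAZdFamOfOps θ.𝔸 θ.L len ops)`, and the SIX junction binders `InvAtH ∕ LandauAt ∕ HolderAtδ2 ∕ LinBddAt ∕ SrcAt ∕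
SrcHolderAtδ2` at every `j : Node00.IdxB8SubD θ` give the N05 row `∃ lam c₁ ρ₀, B8LeafOfRecordSubBP₂D θ (lam.cutSubBP₅ c₁ ρ₀)`.  Proof: dag-n05-e's `…_P6` at
`(geo, GA, ιLoc) := (geoZd, GAZdFamOfOps ops, ιLocZd)`, `ops₀ := withDpZd ops₀`, with `hdict := dictAt_of_global (dictGlob_zd …)` and `hcurv := curvAtInAk_of_Dp_eq …`
(`c69 := 14(D−1)`).  Hypotheses are N06 content; N05 NOT discharged.
[cite: Balaban1985RegularSpaces, Lemma 1 – Thm 8 pp.79–101, (1.3)–(1.5) p.77, (1.59) p.86; Balaban1985BackgroundPropagators, (3.10) p.392, (3.41) p.397, (3.47) p.398, Thm 3.3 p.399, (3.69) p.404] -/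
theorem exists_residB8_b8LeafOfRecordSubBP₂D_cutSubBP₅_of_letters_thm33_junctionH_zdFrame (θ : Stage3Params) (hD : 2 ≤ θ.D) (hL5 : 5 ≤ θ.L)
    [FiniteDimensional ℝ θ.𝔸] :
    ∃ c35₀ M₆ : ℝ, 0 < c35₀ ∧ 0 < M₆ ∧
      ∀ ⦃c35 : ℝ⦄, c35₀ ≤ c35 → ∀ ⦃M₃ : ℝ⦄, M₆ ≤ M₃ →
      -- [Balaban1985BackgroundPropagators] Thm 3.1's letter bounds and threshold
      ∀ {B₀'H B₂' BG BR cL : ℝ}, 0 < B₀'H → 0 ≤ B₂' → 0 ≤ BG → 0 ≤ BR → 0 < cL →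
      -- [4]'s letters AT THE (1.3)–(1.5)-ADMISSIBLE `Ω₀ = ℤᵈ` LAW MEMBERS (p619291's texts verbatim): existence side and uniqueness side
      (∀ i : ZdIdx θ.D θ.L, i.Ω 0 = Set.univ → IdxB8LawsB θ.L i → B8ConstraintBonds.DomainSeq θ.L i.Ω → (∀ l, l < i.k → ∀ z ∈ i.Λs i.k l, ((θ.L : ℤ) ^ l) • z ∈ B8ConstraintBonds.Lam θ.L i.Ω l) → SockLettersRD (𝔸 := θ.𝔸) θ.L BG BR B₀'H B₂' cL i.η i.k i.Ω i.Λs) →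
      (∀ i : ZdIdx θ.D θ.L, i.Ω 0 = Set.univ → IdxB8LawsB θ.L i → B8ConstraintBonds.DomainSeq θ.L i.Ω → (∀ l, l < i.k → ∀ z ∈ i.Λs i.k l, ((θ.L : ℤ) ^ l) • z ∈ B8ConstraintBonds.Lam θ.L i.Ω l) → ∀ α₀ : ℝ, 0 < α₀ → α₀ ≤ cL → ∀ U₀ : Site θ.D → Fin θ.D → θ.𝔸ˣ, (∀ x κ, U₀ x κ ∈ unitaryUnits θ.𝔸) →
        InAk θ.L i.k i.η α₀ i.Ω U₀ →
        ∃ (g Δ : (Site θ.D → θ.𝔸) →ₗ[ℂ] (Site θ.D → θ.𝔸)) (q : (Site θ.D → θ.𝔸) →ₗ[ℂ] (ℕ → Site θ.D → θ.𝔸))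
          (qs : (ℕ → Site θ.D → θ.𝔸) →ₗ[ℂ] (Site θ.D → θ.𝔸)) (Aw c : (ℕ → Site θ.D → θ.𝔸) →ₗ[ℂ] (ℕ → Site θ.D → θ.𝔸))
          (H' : XSpace θ.D i.k θ.𝔸 →ₗ[ℂ] (Site θ.D → θ.𝔸)),
          (∀ x : Site θ.D → θ.𝔸, (∃ C : ℝ, ∀ y, ‖x y‖ ≤ C) → g (Δ x + qs (Aw (q x))) = x) ∧ (∀ φ, qs (c (q (g (g (qs φ))))) = qs φ) ∧
          (∀ (f : Site θ.D → θ.𝔸), ∀ x ∈ i.Ω 0, Δ f x = covLap i.η U₀ ((i.Ω 0).indicator f) x) ∧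
          (∀ (μ : ℕ → Site θ.D → θ.𝔸), ∀ x ∈ i.Ω 0, qs μ x = QT θ.L i.k (i.Λs i.k) U₀ μ x) ∧
          (∀ (f : Site θ.D → θ.𝔸) (n : ℕ), n ≤ i.k → ∀ y ∈ i.Λs i.k n, q f n y = QprimeIter (zdBlocking θ.D θ.L) (bgT θ.L U₀) n f y) ∧
          (∀ (f : Site θ.D → θ.𝔸) (n : ℕ) (y : Site θ.D), ¬ (n ≤ i.k ∧ y ∈ i.Λs i.k n) → q f n y = 0) ∧
          (∀ (X : XSpace θ.D i.k θ.𝔸) (x : Site θ.D), ‖H' X x‖ ≤ B₀'H * ‖X‖) ∧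
          (∀ n, n ≤ i.k → ∀ (X : XSpace θ.D i.k θ.𝔸), ∀ p ∈ {b : Site θ.D × Fin θ.D | SideTouches (i.Ω n) b.1 b.2},
            wt θ.L i.η n * ‖covDerivFwd i.η U₀ p.2 (H' X) p.1‖ ≤ B₀'H * ‖X‖) ∧
          (∀ X : XSpace θ.D i.k θ.𝔸, Bd2 θ.L i.η i.k i.Ω (covLap i.η U₀ (H' X)) (B₂' * ‖X‖)) ∧
          (∀ (Y : XSpace θ.D i.k θ.𝔸) (n : ℕ) (hn : n ≤ i.k) (y : Site θ.D), y ∈ i.Λs i.k n →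
            QprimeIter (zdBlocking θ.D θ.L) (bgT θ.L U₀) n (H' Y) y = Y (⟨n, Nat.lt_succ_of_le hn⟩, y)) ∧
          (∀ (f : Site θ.D → θ.𝔸) (r : ℝ), 0 ≤ r → Bd2 θ.L i.η i.k i.Ω f r →
            (∀ x, ‖g f x‖ ≤ BG * r) ∧ ∀ n, n ≤ i.k → ∀ p ∈ {b : Site θ.D × Fin θ.D | SideTouches (i.Ω n) b.1 b.2},
              wt θ.L i.η n * ‖covDerivFwd i.η U₀ p.2 (g f) p.1‖ ≤ BG * r) ∧
          (∀ (f : Site θ.D → θ.𝔸) (r : ℝ), 0 ≤ r → Bd2 θ.L i.η i.k i.Ω f r → Bd2 θ.L i.η i.k i.Ω (f - g (qs (c (q (g f))))) (BR * r))) →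
      -- N06's `ℤᵈ` FRAME OF RECORD (dag-n06-e): lengths `len`, geometries `geoZd`, backgrounds `bgZd`, the kernel family `GAZdFamOfOps … ops` READ OFF the letters `ops`
      -- (dag-n06-e's `B9SupplySockB9P3ZdLocalLettersOfOps`), locality map `ιLocZd`; the (3.8)-side family `Gp` of Theorems 3.1–3.2 stays free (read by `Thm33Printed` only)
      ∀ (len : Site θ.D → ℝ) (Gp : ∀ x, B9.KernelFamily (geoZd θ.𝔸 θ.L len x) (bgZd θ.𝔸 θ.L x))
        (ops : ℝ → ZdIdx θ.D θ.L → ℕ → OpsZd θ.D θ.𝔸)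
      -- THE GENUINE AVERAGING LETTER `Q*aQ` (EDITION P, dag-n06-b) AND THE GENUINE CURVATURE LETTER `Δ′(U₀)` (dag-n06-w2's `withDpZd`), pinned pointwise
        (τ : θ.𝔸 →ₗ[ℂ] ℂ) {Cτ : ℝ}, (∀ x y : θ.𝔸, |(τ (star x * y)).re| ≤ Cτ * ‖x‖ * ‖y‖) →
      ∀ (ops₀ : ℝ → ZdIdx θ.D θ.L → ℕ → OpsZd θ.D θ.𝔸),
        (∀ (M : ℝ) (i : ZdIdx θ.D θ.L) (m : ℕ), ops M i m = withQQP τ θ.L (fun m' l => towerBondsP θ.L i.Ω (i.Λs m') l) (withDpZd ops₀) M i m) →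
      ∀ {a₃ β cS cSβ : ℝ} {CH : ℝ → ℝ},
      -- N06's THEOREM 3.3 AS PRINTED — ITS NODE SENTENCE (γ) AT THE `ℤᵈ` FRAME OF RECORD, VERBATIM (the kernel family of `G(U₀)` read off `ops`)
        B9.Thm33Printed c35 (geoZd θ.𝔸 θ.L len) (bgZd θ.𝔸 θ.L) Gp (GAZdFamOfOps θ.𝔸 θ.L len ops) →
      -- dag-n06-b's JUNCTION BINDERS at the (1.3)–(1.5)-admissible members, guarded — SIX of them: NO `havg` (dag-n05-d g13 C), NO `hP6` (dag-n05-e), NO `hdict`, NO `hcurv` (this file)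
        (∀ (M : ℝ) (j : IdxB8SubD θ) (m : ℕ), 1 ≤ M → M₃ ≤ M → m ≤ j.1.1.1.1.k → InvAtH (bgZd θ.𝔸 θ.L) θ.L memZd (ιCfgZd θ.𝔸 θ.L) ops c35 a₃ M j.1.1.1.1 m) →
        (∀ (M : ℝ) (j : IdxB8SubD θ) (m : ℕ), 1 ≤ M → M₃ ≤ M → m ≤ j.1.1.1.1.k → LandauAt (bgZd θ.𝔸 θ.L) θ.L memZd (ιCfgZd θ.𝔸 θ.L) ops c35 a₃ M j.1.1.1.1 m) →
        (∀ (M : ℝ) (j : IdxB8SubD θ) (m : ℕ), 1 ≤ M → M₃ ≤ M → m ≤ j.1.1.1.1.k → HolderAtδ2 (geoZd θ.𝔸 θ.L len) (bgZd θ.𝔸 θ.L) (GAZdFamOfOps θ.𝔸 θ.L len ops) θ.L memZd (ιCfgZd θ.𝔸 θ.L) ops β len CH M j.1.1.1.1 m) →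
        (∀ (M : ℝ) (j : IdxB8SubD θ) (m : ℕ), 1 ≤ M → M₃ ≤ M → m ≤ j.1.1.1.1.k → LinBddAt θ.L ops M j.1.1.1.1 m) →
        (∀ (M : ℝ) (j : IdxB8SubD θ) (m : ℕ), 1 ≤ M → M₃ ≤ M → m ≤ j.1.1.1.1.k → SrcAt (bgZd θ.𝔸 θ.L) θ.L memZd (ιCfgZd θ.𝔸 θ.L) ops c35 a₃ cS M j.1.1.1.1 m) →
        (∀ (M : ℝ) (j : IdxB8SubD θ) (m : ℕ), 1 ≤ M → M₃ ≤ M → m ≤ j.1.1.1.1.k → SrcHolderAtδ2 (bgZd θ.𝔸 θ.L) θ.L memZd (ιCfgZd θ.𝔸 θ.L) ops c35 a₃ β len cSβ M j.1.1.1.1 m) →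
      -- the junction's primitive constants ((3.27) `a₃`, source `c_S c_Sβ`; (3.69)'s `c69` is now `14(D−1)`, dag-n06-w2) and Theorem 8's source size factor `γ₈`
        0 < a₃ → 0 ≤ cS → 0 ≤ cSβ → ∀ {γ₈ : ℝ}, 1 ≤ γ₈ →
        ∃ (lam : ResidB8 θ) (c₁ : ℝ) (ρ₀ : ℕ), B8LeafOfRecordSubBP₂D θ (lam.cutSubBP₅ c₁ ρ₀)  := by
  have hL1 : 1 ≤ θ.L := le_trans (by norm_num) hL5
  -- dag-n05-e's P₆-discharged row at an ABSTRACT half-frame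
  obtain ⟨c35₀, M₆, hc35₀, hM₆, H⟩ :=
    exists_residB8_b8LeafOfRecordSubBP₂D_cutSubBP₅_of_letters_thm33_junctionH_withQQP_P6 θ hD hL5
  refine ⟨c35₀, M₆, hc35₀, hM₆, ?_⟩
  intro c35 hc35 M₃ hM₃ B₀'H B₂' BG BR cL hB₀'H hB₂' hBG hBR hcL SLet SLetUB len Gp ops τ Cτ hCτ ops₀ hops a₃ β cS cSβ CH
    h33 hinv hlan hhol hlin hsrc hsrcH ha₃ hcS hcSβ γ₈ hγ₈
  -- THE NORM DICTIONARY IS A THEOREM AT N06's FRAME OF RECORD, for THIS `ops` (dag-n06-e `dictGlob_zd`, read through `GAZdFamOfOps_eq`)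
  have hDG : DictGlob (geoZd θ.𝔸 θ.L len) (bgZd θ.𝔸 θ.L) (GAZdFamOfOps θ.𝔸 θ.L len ops) θ.L memZd (ιCfgZd θ.𝔸 θ.L) (ιLocZd θ.𝔸 θ.L len) ops := by
    rw [GAZdFamOfOps_eq]
    exact dictGlob_zd len ops _
  -- THE CURVATURE LETTER IS GENUINE AT EVERY MEMBER (the pin, dag-n06-b `withQQP_Dp`, dag-n06-w2 `withDpZd_Dp`)
  have hDp : ∀ (M : ℝ) (i : ZdIdx θ.D θ.L) (m : ℕ), (ops M i m).Dp = DpZd i.η := fun M i m => by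
    rw [hops, withQQP_Dp, withDpZd_Dp]
  exact H hc35 hM₃ hB₀'H hB₂' hBG hBR hcL SLet SLetUB (geoZd θ.𝔸 θ.L len) Gp (GAZdFamOfOps θ.𝔸 θ.L len ops) (ιLocZd θ.𝔸 θ.L len) ops τ hCτ
    (withDpZd ops₀) hops h33 (fun M j m _ _ _ => dictAt_of_global hDG M j.1.1.1.1 m) hinv
    (fun M j m hM1 _ _ => curvAtInAk_of_Dp_eq hL1 hDp hM1 j.1.1.1.1 m) hlan hhol hlin hsrc hsrcH ha₃ (by positivity) hcS hcSβ hγ₈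

end AtZdFrame

section AtZdFrameI

open Summit.QuantumFields.YangMills.BalabanUVNodes.N05SubBP2DSlotExistsOfThm33JunctionHWithQQPP6
  (exists_residB8_b8LeafOfRecordSubBP₂D_cutSubBP₅_of_letters_thm33_junctionH_withQQP_P6I)

/-- ★★★ **THE INDEX-GENERIC EDITION (§2, v1.1): THE `ℤᵈ` FRAME OF RECORD THROUGH A RE-INDEXING MAP `π : I → MemberZd θ.D θ.L`** — for `θ` with `2 ≤ θ.D`, `5 ≤ θ.L`:
Proposition 6 produces `c35₀, M₆ > 0` such that for every `c35 ≥ c35₀`, `M₃ ≥ M₆`, [4]'s letters `SLet ∕ SLetUB`, any index `I` with `π : I → MemberZd θ.D θ.L`, member map `mem`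
with `π (mem M j m) = memZd M j m` at the admissible members, any `len`, any (3.8)-family `Gp` over `I`, any letter family `ops` with the pin `hops` (genuine `Q*aQ`, `Δ′`),
N06's sentence `B9.Thm33Printed c35 (geoZd … ∘ π) (bgZd … ∘ π) Gp (GAZdFamOfOps … ops ∘ π)` OVER `I` (sound sub-indices are the consumer's choice — dag-n06-b LOCATED-SELF-7),
and the SIX junction binders at every `j : Node00.IdxB8SubD θ` give `∃ lam c₁ ρ₀, B8LeafOfRecordSubBP₂D θ (lam.cutSubBP₅ c₁ ρ₀)`.  Proof: dag-n05-e's `…_P6I` at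
`(geo, GA, ιLoc) := (geoZd ∘ π, GAZdFamOfOps ops ∘ π, id)`, `ops₀ := withDpZd ops₀`; `hcurv := curvAtInAk_of_Dp_eq`; `hdict` = the frame-of-record dictionary
`dictAt_of_global (dictGlob_zd …)` TRANSPORTED along `hmem` (the binder unfolded, `π (mem M j m)` rewritten to `memZd M j m`).  Hypotheses are N06 content; N05 NOT discharged.
[cite: Balaban1985RegularSpaces, Lemma 1 – Thm 8 pp.79–101, (1.3)–(1.5) p.77, (1.59) p.86; Balaban1985BackgroundPropagators, (3.10) p.392, (3.41) p.397, (3.47) p.398, Thm 3.3 p.399, (3.69) p.404] -/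
theorem exists_residB8_b8LeafOfRecordSubBP₂D_cutSubBP₅_of_letters_thm33_junctionH_zdFrameI (θ : Stage3Params) (hD : 2 ≤ θ.D) (hL5 : 5 ≤ θ.L)
    [FiniteDimensional ℝ θ.𝔸] :
    ∃ c35₀ M₆ : ℝ, 0 < c35₀ ∧ 0 < M₆ ∧
      ∀ ⦃c35 : ℝ⦄, c35₀ ≤ c35 → ∀ ⦃M₃ : ℝ⦄, M₆ ≤ M₃ →
      -- [Balaban1985BackgroundPropagators] Thm 3.1's letter bounds and threshold
      ∀ {B₀'H B₂' BG BR cL : ℝ}, 0 < B₀'H → 0 ≤ B₂' → 0 ≤ BG → 0 ≤ BR → 0 < cL →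
      -- [4]'s letters AT THE (1.3)–(1.5)-ADMISSIBLE `Ω₀ = ℤᵈ` LAW MEMBERS (p619291's texts verbatim): existence side and uniqueness side
      (∀ i : ZdIdx θ.D θ.L, i.Ω 0 = Set.univ → IdxB8LawsB θ.L i → B8ConstraintBonds.DomainSeq θ.L i.Ω → (∀ l, l < i.k → ∀ z ∈ i.Λs i.k l, ((θ.L : ℤ) ^ l) • z ∈ B8ConstraintBonds.Lam θ.L i.Ω l) → SockLettersRD (𝔸 := θ.𝔸) θ.L BG BR B₀'H B₂' cL i.η i.k i.Ω i.Λs) →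
      (∀ i : ZdIdx θ.D θ.L, i.Ω 0 = Set.univ → IdxB8LawsB θ.L i → B8ConstraintBonds.DomainSeq θ.L i.Ω → (∀ l, l < i.k → ∀ z ∈ i.Λs i.k l, ((θ.L : ℤ) ^ l) • z ∈ B8ConstraintBonds.Lam θ.L i.Ω l) → ∀ α₀ : ℝ, 0 < α₀ → α₀ ≤ cL → ∀ U₀ : Site θ.D → Fin θ.D → θ.𝔸ˣ, (∀ x κ, U₀ x κ ∈ unitaryUnits θ.𝔸) →
        InAk θ.L i.k i.η α₀ i.Ω U₀ →
        ∃ (g Δ : (Site θ.D → θ.𝔸) →ₗ[ℂ] (Site θ.D → θ.𝔸)) (q : (Site θ.D → θ.𝔸) →ₗ[ℂ] (ℕ → Site θ.D → θ.𝔸))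
          (qs : (ℕ → Site θ.D → θ.𝔸) →ₗ[ℂ] (Site θ.D → θ.𝔸)) (Aw c : (ℕ → Site θ.D → θ.𝔸) →ₗ[ℂ] (ℕ → Site θ.D → θ.𝔸))
          (H' : XSpace θ.D i.k θ.𝔸 →ₗ[ℂ] (Site θ.D → θ.𝔸)),
          (∀ x : Site θ.D → θ.𝔸, (∃ C : ℝ, ∀ y, ‖x y‖ ≤ C) → g (Δ x + qs (Aw (q x))) = x) ∧ (∀ φ, qs (c (q (g (g (qs φ))))) = qs φ) ∧
          (∀ (f : Site θ.D → θ.𝔸), ∀ x ∈ i.Ω 0, Δ f x = covLap i.η U₀ ((i.Ω 0).indicator f) x) ∧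
          (∀ (μ : ℕ → Site θ.D → θ.𝔸), ∀ x ∈ i.Ω 0, qs μ x = QT θ.L i.k (i.Λs i.k) U₀ μ x) ∧
          (∀ (f : Site θ.D → θ.𝔸) (n : ℕ), n ≤ i.k → ∀ y ∈ i.Λs i.k n, q f n y = QprimeIter (zdBlocking θ.D θ.L) (bgT θ.L U₀) n f y) ∧
          (∀ (f : Site θ.D → θ.𝔸) (n : ℕ) (y : Site θ.D), ¬ (n ≤ i.k ∧ y ∈ i.Λs i.k n) → q f n y = 0) ∧
          (∀ (X : XSpace θ.D i.k θ.𝔸) (x : Site θ.D), ‖H' X x‖ ≤ B₀'H * ‖X‖) ∧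
          (∀ n, n ≤ i.k → ∀ (X : XSpace θ.D i.k θ.𝔸), ∀ p ∈ {b : Site θ.D × Fin θ.D | SideTouches (i.Ω n) b.1 b.2},
            wt θ.L i.η n * ‖covDerivFwd i.η U₀ p.2 (H' X) p.1‖ ≤ B₀'H * ‖X‖) ∧
          (∀ X : XSpace θ.D i.k θ.𝔸, Bd2 θ.L i.η i.k i.Ω (covLap i.η U₀ (H' X)) (B₂' * ‖X‖)) ∧
          (∀ (Y : XSpace θ.D i.k θ.𝔸) (n : ℕ) (hn : n ≤ i.k) (y : Site θ.D), y ∈ i.Λs i.k n →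
            QprimeIter (zdBlocking θ.D θ.L) (bgT θ.L U₀) n (H' Y) y = Y (⟨n, Nat.lt_succ_of_le hn⟩, y)) ∧
          (∀ (f : Site θ.D → θ.𝔸) (r : ℝ), 0 ≤ r → Bd2 θ.L i.η i.k i.Ω f r →
            (∀ x, ‖g f x‖ ≤ BG * r) ∧ ∀ n, n ≤ i.k → ∀ p ∈ {b : Site θ.D × Fin θ.D | SideTouches (i.Ω n) b.1 b.2},
              wt θ.L i.η n * ‖covDerivFwd i.η U₀ p.2 (g f) p.1‖ ≤ BG * r) ∧
          (∀ (f : Site θ.D → θ.𝔸) (r : ℝ), 0 ≤ r → Bd2 θ.L i.η i.k i.Ω f r → Bd2 θ.L i.η i.k i.Ω (f - g (qs (c (q (g f))))) (BR * r))) →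
      -- ANY INDEX re-indexed into the `ℤᵈ` members of record by `π`, a member map landing on `memZd` at the admissible members, and N06's `ℤᵈ` FRAME OF RECORD
      -- READ THROUGH `π` (dag-n06-e): lengths `len`, geometries `geoZd ∘ π`, backgrounds `bgZd ∘ π`, the kernel family `GAZdFamOfOps … ops ∘ π` READ OFF the letters `ops`,
      -- locality map the identity; the (3.8)-side family `Gp` of Theorems 3.1–3.2 stays free (read by `Thm33Printed` only)
      ∀ {I : Type} (π : I → MemberZd θ.D θ.L) (len : Site θ.D → ℝ) (Gp : ∀ i, B9.KernelFamily (geoZd θ.𝔸 θ.L len (π i)) (bgZd θ.𝔸 θ.L (π i)))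
        (mem : ℝ → ZdIdx θ.D θ.L → ℕ → I),
        (∀ (M : ℝ) (j : IdxB8SubD θ) (m : ℕ), π (mem M j.1.1.1.1 m) = memZd M j.1.1.1.1 m) →
      ∀ (ops : ℝ → ZdIdx θ.D θ.L → ℕ → OpsZd θ.D θ.𝔸)
      -- THE GENUINE AVERAGING LETTER `Q*aQ` (EDITION P, dag-n06-b) AND THE GENUINE CURVATURE LETTER `Δ′(U₀)` (dag-n06-w2's `withDpZd`), pinned pointwise
        (τ : θ.𝔸 →ₗ[ℂ] ℂ) {Cτ : ℝ}, (∀ x y : θ.𝔸, |(τ (star x * y)).re| ≤ Cτ * ‖x‖ * ‖y‖) →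
      ∀ (ops₀ : ℝ → ZdIdx θ.D θ.L → ℕ → OpsZd θ.D θ.𝔸),
        (∀ (M : ℝ) (i : ZdIdx θ.D θ.L) (m : ℕ), ops M i m = withQQP τ θ.L (fun m' l => towerBondsP θ.L i.Ω (i.Λs m') l) (withDpZd ops₀) M i m) →
      ∀ {a₃ β cS cSβ : ℝ} {CH : ℝ → ℝ},
      -- N06's THEOREM 3.3 AS PRINTED — ITS NODE SENTENCE (γ) AT THE `ℤᵈ` FRAME OF RECORD READ THROUGH `π` (over `I`: sound sub-indices are the consumer's choice)
        B9.Thm33Printed c35 (fun i => geoZd θ.𝔸 θ.L len (π i)) (fun i => bgZd θ.𝔸 θ.L (π i)) Gp (fun i => GAZdFamOfOps θ.𝔸 θ.L len ops (π i)) →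
      -- dag-n06-b's JUNCTION BINDERS at the (1.3)–(1.5)-admissible members, guarded — SIX of them: NO `havg` (dag-n05-d g13 C), NO `hP6` (dag-n05-e), NO `hdict`, NO `hcurv` (this file)
        (∀ (M : ℝ) (j : IdxB8SubD θ) (m : ℕ), 1 ≤ M → M₃ ≤ M → m ≤ j.1.1.1.1.k → InvAtH (fun i => bgZd θ.𝔸 θ.L (π i)) θ.L mem (fun M i m U₀ hU₀ => ιCfgZd θ.𝔸 θ.L M i m U₀ hU₀) ops c35 a₃ M j.1.1.1.1 m) →
        (∀ (M : ℝ) (j : IdxB8SubD θ) (m : ℕ), 1 ≤ M → M₃ ≤ M → m ≤ j.1.1.1.1.k → LandauAt (fun i => bgZd θ.𝔸 θ.L (π i)) θ.L mem (fun M i m U₀ hU₀ => ιCfgZd θ.𝔸 θ.L M i m U₀ hU₀) ops c35 a₃ M j.1.1.1.1 m) →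
        (∀ (M : ℝ) (j : IdxB8SubD θ) (m : ℕ), 1 ≤ M → M₃ ≤ M → m ≤ j.1.1.1.1.k → HolderAtδ2 (fun i => geoZd θ.𝔸 θ.L len (π i)) (fun i => bgZd θ.𝔸 θ.L (π i)) (fun i => GAZdFamOfOps θ.𝔸 θ.L len ops (π i)) θ.L mem (fun M i m U₀ hU₀ => ιCfgZd θ.𝔸 θ.L M i m U₀ hU₀) ops β len CH M j.1.1.1.1 m) →
        (∀ (M : ℝ) (j : IdxB8SubD θ) (m : ℕ), 1 ≤ M → M₃ ≤ M → m ≤ j.1.1.1.1.k → LinBddAt θ.L ops M j.1.1.1.1 m) →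
        (∀ (M : ℝ) (j : IdxB8SubD θ) (m : ℕ), 1 ≤ M → M₃ ≤ M → m ≤ j.1.1.1.1.k → SrcAt (fun i => bgZd θ.𝔸 θ.L (π i)) θ.L mem (fun M i m U₀ hU₀ => ιCfgZd θ.𝔸 θ.L M i m U₀ hU₀) ops c35 a₃ cS M j.1.1.1.1 m) →
        (∀ (M : ℝ) (j : IdxB8SubD θ) (m : ℕ), 1 ≤ M → M₃ ≤ M → m ≤ j.1.1.1.1.k → SrcHolderAtδ2 (fun i => bgZd θ.𝔸 θ.L (π i)) θ.L mem (fun M i m U₀ hU₀ => ιCfgZd θ.𝔸 θ.L M i m U₀ hU₀) ops c35 a₃ β len cSβ M j.1.1.1.1 m) →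
      -- the junction's primitive constants ((3.27) `a₃`, source `c_S c_Sβ`; (3.69)'s `c69` is now `14(D−1)`, dag-n06-w2) and Theorem 8's source size factor `γ₈`
        0 < a₃ → 0 ≤ cS → 0 ≤ cSβ → ∀ {γ₈ : ℝ}, 1 ≤ γ₈ →
        ∃ (lam : ResidB8 θ) (c₁ : ℝ) (ρ₀ : ℕ), B8LeafOfRecordSubBP₂D θ (lam.cutSubBP₅ c₁ ρ₀)  := by
  have hL1 : 1 ≤ θ.L := le_trans (by norm_num) hL5
  obtain ⟨c35₀, M₆, hc35₀, hM₆, H⟩ :=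
    exists_residB8_b8LeafOfRecordSubBP₂D_cutSubBP₅_of_letters_thm33_junctionH_withQQP_P6I θ hD hL5
  refine ⟨c35₀, M₆, hc35₀, hM₆, ?_⟩
  intro c35 hc35 M₃ hM₃ B₀'H B₂' BG BR cL hB₀'H hB₂' hBG hBR hcL SLet SLetUB I π len Gp mem hmem ops τ Cτ hCτ ops₀ hops a₃ β cS cSβ CH
    h33 hinv hlan hhol hlin hsrc hsrcH ha₃ hcS hcSβ γ₈ hγ₈
  -- THE NORM DICTIONARY IS A THEOREM AT N06's FRAME OF RECORD, for THIS `ops` (dag-n06-e `dictGlob_zd`, read through `GAZdFamOfOps_eq`)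
  have hDG : DictGlob (geoZd θ.𝔸 θ.L len) (bgZd θ.𝔸 θ.L) (GAZdFamOfOps θ.𝔸 θ.L len ops) θ.L memZd (ιCfgZd θ.𝔸 θ.L) (ιLocZd θ.𝔸 θ.L len) ops := by
    rw [GAZdFamOfOps_eq]
    exact dictGlob_zd len ops _
  -- THE CURVATURE LETTER IS GENUINE AT EVERY MEMBER (the pin)
  have hDp : ∀ (M : ℝ) (i : ZdIdx θ.D θ.L) (m : ℕ), (ops M i m).Dp = DpZd i.η := fun M i m => by
    rw [hops, withQQP_Dp, withDpZd_Dp]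
  refine H hc35 hM₃ hB₀'H hB₂' hBG hBR hcL SLet SLetUB π (fun i => geoZd θ.𝔸 θ.L len (π i)) Gp (fun i => GAZdFamOfOps θ.𝔸 θ.L len ops (π i)) mem hmem
    (fun M i m J => J) ops τ hCτ (withDpZd ops₀) hops h33 ?_ hinv (fun M j m hM1 _ _ => curvAtInAk_of_Dp_eq hL1 hDp hM1 j.1.1.1.1 m) hlan hhol hlin hsrc hsrcH
    ha₃ (by positivity) hcS hcSβ hγ₈
  -- `hdict` AT THE GENERIC INDEX: the frame-of-record dictionary at `memZd M j m`, transported along `hmem`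
  intro M j m _ _ _
  have h := dictAt_of_global hDG M j.1.1.1.1 m
  simp only [DictAt] at h ⊢
  rw [hmem M j m]
  exact h

end AtZdFrameI

end Summit.QuantumFields.YangMills.BalabanUVNodes.N05SubBP2DSlotExistsOfThm33JunctionHAtZdFrame

end
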